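/-
Copyright: statement-level skeleton of a published paper (lit-balaban cell, Phase-2 proof seat p37 gen 90). No claims beyond
what the kernel checks below.
-/
import Mathlib
import Literature.MathematicalPhysics.QuantumFieldTheory.Balaban1983to89.B3Eq332Pictures
import Literature.MathematicalPhysics.QuantumFieldTheory.Balaban1983to89.B3Eq322OneLegDifferentiated
import Literature.MathematicalPhysics.QuantumFieldTheory.Balaban1983to89.B3Eq322Member

/-!
# B3 — T. Bałaban, *(Higgs)₂,₃ quantum fields in a finite volume. III. Renormalization*, CMP **88** (1983) 411–445
[Balaban1983Higgs3] — pp. 438–439 [PDF 28–29]: the PICTURES **(3.21)** (the two two-scalar-leg graphs with one leg differentiated)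
and the PICTURE EQUATION **(3.22)** (the second of them = a Hölder-decorated picture "+α / −(1+α)" + a local vertex) AS DRAWN OBJECTS
of the concrete graph model (`B3Cor23Concrete.Graph`, line kinds visible; p26's pictures-with-localized-legs
`B3Eq37Pictures.LocPicture`, this seat's decorated pictures `B3Eq332Pictures.HolderPicture`), the COUNT DATA of the drawn objects
(DERIVED: the p19 datum read off the drawing IS p18 g8's `B3Eq322Member.graph322`), and the DICTIONARY from the drawn objects to
p18 g8's typed expressions `B3Eq322OneLegDifferentiated.expr321a`/`expr321b`/`holder322` and r15's `B3Sect3ScalarSelfEnergy.expr323`,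
under which (3.22) IS p18 g8's PROVED identity `eq322`

statement-level skeleton of published theorems with citation tags; proofs where landed; nothing here is a claim about
the Yang–Mills mass gap

PDF held: `paper:balaban1983-higgs-2-3-quantum-fields-finite-volume` (journal page = PDF page + 410); pp. 417, 438, 439 [PDF 7, 28,
29] read on the ×2 renders `run/shared/lean/pub/pub-balaban/b2b-balaban-ref1/pages/1983-cmp88-higgs23-III/1983-cmp88-higgs23-III-p028-x2.png`,
`…-p029-x2.png` (the pictures (3.21), (3.22), re-read by this seat 2026-08-23).

CITATION HEADER (lean-in-tree rule).  lit-balaban TYPED SKELETON (HOME `run/shared/lean/pub/lit-balaban/`), PHASE 2, seat p37 gen 90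
(unit `lit-balaban-p37-g90`; TAKING line HOME/STATUS.md 2026-08-23T02:42:54Z), free target named by the fold owner r15 g14 (OWNER
RULING 2026-08-23T02:10:35Z: *"B3.Eq3.21-3.24 residual (iv) = the (3.21)/(3.22) PICTURES AT GRAPH LEVEL in p26 g33's Q1 format
(`B3Eq37Pictures`: `LocPicture` with line kinds on p18's model graphs `g321a`/`g321b`, count data DERIVED from the drawn objects,
explicit DICTIONARY lemmas from the drawn objects' amplitudes to p18 g8's expressions `expr321a`/`expr321b` and to the two (3.22)
right-hand pictures / `eq322`'s terms)"*).  ROW **B3.Eq3.21-3.24** of `HOME/lit-balaban-r15/ROWS-B3.md` (fold owner r15, referee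
ref-4), residual (iv).  CONSUMES BY NAME: p26 gen 33's `B3Eq37Pictures` (`LocPicture`, `LocPicture.natural`, `LocPicture.amp`,
`kernel2`, `amp_natural_oneVertex`, `kind36`, `sLeg`, `vLeg`, `legDiffs`, `legAvg`, `legDiffs36`, `LineEnum`, `countsOf`), this seat's
`B3Eq332Pictures.HolderPicture` (+ `HolderPicture.deg`, `VBlob.holder`), p18 gen 3's drawn graphs `B3Sect3LowestOrderGraphs.g321a`/
`g321b` (`g321a_deg`, `g321b_deg`; p248264), p18 gen 8's `B3Eq322OneLegDifferentiated` (`expr321a`, `ker321`, `expr321b`, `rem322`,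
`holder322`, **`eq322`**, `rem322_eq_holder322`) and `B3Eq322Member` (`graph322`, `κ322`, `degQ_one`, `degQ_two`, `degQK_two`), r15's
`B3Sect3ScalarSelfEnergy` (`Kernel`, `d1Kernel`, `bracket323`, `expr323`, `bracket323` via p18's `bracket323_eq`).

THE PRINTED TEXT (verbatim, pp. 438–439).  *"We have to consider another class of graphs with two external scalar field legs, the
graphs with one leg differentiated. There are only two such graphs: [picture a] , [picture b] (3.21) The expression corresponding to
the first graph is in fact convergent, because ηG_k(x,x) is convergent to some finite constant as η → 0. The second expression is
transformed in a way similar to (3.17) and (3.20): [picture b] = [picture b inscribed +α, its arrowed external leg labelled −(1+α)]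
+ [a local vertex] (3.22) The first graph on the right side has positive degree, the second is treated in the same way as the
expression (3.15): we sum over proper orderings and j-indices and we get Σ_{μ=1}^d Σ_x η^dφ(x)·[q²Σ_{x′}η^d(∂^η_μG^η_{j″}(0))(x,x′)
g(x)G^η_{j″}(x,x′)g′(x′)](∂^η_μφ′)(x). (3.23) … Hence the last graph in (3.22) defines a vertex —•→— with some convergent
function."*; p. 438, first paragraph: *"All the remaining divergent graphs of this type have degrees equal to 0."*; p. 417 [PDF 7]:
*"δm²_G … will be represented by the same graph G but with both external legs localized in x and with the summation over x′."*;
p. 415 legend (1.17): straight line = φ′, wavy line = A′, arrowhead = the covariant differentiation.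
READING OF THE PICTURES (pp. 438–439 renders).  (3.21)a = one vertex carrying a wavy LOOP (both its A′-legs joined) and two
straight external legs, one arrowed — p18's `g321a` (the vertex (1.8)_{2,0}); (3.21)b = two vertices x, x′ joined by a straight
line arrowed at x (the φ′-line through the differentiated leg of x) and by a wavy line (the A′-line), the plain external leg at x
and the ARROWED external leg at x′ — p18's `g321b` (two (1.8)_{1,0}); (3.22) LHS = (3.21)b; RHS₁ = (3.21)b inscribed "+α" with
"−(1+α)" on the arrowed external leg of x′ (one covariant differentiation + the Hölder quotient of order α relative to x — p18 g8's
`holder322`); RHS₂ = the vertex x carrying BOTH external legs (the plain one and the arrowed one) with the wavy line and the arrowed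
straight line running to a small circle = the vertex x′ summed over: by p. 417 *the same graph with both external legs localized in
x* — whose expression is r15's pre-resummation (3.23) `expr323` (p18 g8's reading, `eq322`).

WHAT IS TYPED / PROVED (definitions with bodies + theorems; no `Prop` fact, no `sorry`; standard axioms).
§1 DRAWN OBJECTS.  Closed forms `kind321a`/`aLeg`/`wLeg`/`other321a` of (3.21)a and `other321b` of (3.21)b (p18's `g321a.other`,
`g321b.other` definitionally: `g321a_other`, `g321b_other`; (3.21)b has p26's vertices `kind36`); LINE KINDS DECIDED: `g321a_lines`
(the wavy loop; both straight legs external), `g321b_lines` (the φ′-line from the ARROWED leg `sLeg 0 0` of x to the plain leg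
`sLeg 1 1` of x′, the A′-line `vLeg 0`–`vLeg 1`), `other321b_eq_none_iff` (external = the plain leg `sLeg 0 1` of x and the ARROWED
leg `sLeg 1 0` of x′), `legDiffs_ext321b`/`legDiffs_ext321a` (the arrowheads: `legDiffs = 1` on `sLeg 1 0` and on `aLeg 0`, `0` on the plain legs); the
pictures **`pic321a`**, **`pic321b`** (natural localization), **`pic322loc`** (RHS₂: `g321b` with BOTH external legs at x — `loc322`,
`loc322_eq`, `loc322_ext`, `pic322loc_ne_pic321b`), **`pic322holder α`** (RHS₁: `HolderPicture` on `pic321b`, exponent α, decorated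
leg = the arrowed external leg of x′, base x; `pic322holder_data`), **`pic322`** (the triple).
§2 COUNT DATA.  `legOrder` := (differentiations carried by the decorated leg) + α — the printed leg label:
**`legOrder_pic322holder = 1 + α`** ("−(1+α)", DERIVED from the arrowhead of the drawn leg) and, for the vector blob of (3.32),
`legOrder_vholder = α` ("−α"); degrees: `g321b_degZero`/`g321a_degZero` ((3.21)a,b have D = 3 − d = 0 at d = 3 — *"degrees equal to 0"*, p18's
`g321a_deg`/`g321b_deg`), **`deg_pic322holder`** (RHS₁ has degree 3 − d + α, `= α > 0` at d = 3: *"The first graph on the right side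
has positive degree"*; analytic content = p18 g8's `B3Eq322Member.posSubgraphs_memberK322`/`B3Eq322PositiveDegree`, cited); the p19
datum DERIVED from the drawing: `enum321b` (p26's `LineEnum`; `enum321b_kinds`: line `0` SCALAR x→x′ from the arrowed leg, line `1`
VECTOR), **`countsOf_g321b : countsOf (g321b n̄ hn) (enum321b hn) 3 2 1 ⋯ = graph322`** (p18 g8's datum IS the one read off p18 g3's
drawing; `pattern321b` DECIDED), transported: `degQ_one_countsOf_g321b`, `degQ_two_countsOf_g321b` (D = 0 along either ordering),
`degQK_two_countsOf_g321b` (with p18 g8's extra exponent `κ322` = ½ on the scalar line: degree ½ > 0).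
§3 DICTIONARY (p26's scalar-leg `LocPicture.amp`; the kernel of (3.21)b READ OFF ITS LINES: arrowed φ′-line ↦ (∂^η_μG_{(j)}(0))(x,x′)
= r15's `d1Kernel`, A′-line ↦ G_{(j′)}(x,x′), vertices ↦ g(x)q, g′(x′)q — p18 g8's `ker321`·q² =: `sg321`; the arrowed external leg
reads (∂^η_μφ′) = `pdiff η⁻¹ μ φ′`, the direction μ shared with the line and summed, as in (3.23)): `amp_pic321b_kernel2`,
`amp_pic322loc_kernel2`, **`expr321b_eq_amp`** ((3.21)b ↦ p18 g8's `expr321b`), **`expr323_eq_amp`** (RHS₂ ↦ r15's `expr323`, *"with the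
summation over x′"*), the decorated amplitude **`ampD`** (kernel × |x−x′|^α, decorated leg ↦ its difference quotient of order α) with
**`holder322_eq_ampD`** (RHS₁ ↦ p18 g8's `holder322`), and **`eq322_pic`**: Σ_μ amp[(3.21)b] = Σ_μ ampD[RHS₁] + Σ_μ amp[RHS₂] for every
η, every `dist` positive off the diagonal, all kernels and fields — p18 g8's PROVED `eq322` + `rem322_eq_holder322` BY NAME; (3.21)a:
`kernel1`, `k321a`, `amp_pic321a`, **`expr321a_eq_amp`** ((3.21)a ↦ p18 g8's `expr321a`, a LOCAL vertex: one drawn vertex, p26's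
`amp_natural_oneVertex`).
HONEST SCOPE.  (i) As in `B3Eq37Pictures`/`B3Eq332Pictures`: localization and decoration data and the amplitudes are this cell's
READING of pp. 417/438–439 on top of p18's model (no amplitude map of its own); kernels are supplied by the caller and are here the
printed propagators of the lines (p18 g8's `ker321`).  (ii) The count datum has d = 3, L = 2, δ₁ = 1 as in `B3Eq322Member`; no
`Counts` datum is derived for the one-vertex loop graph (3.21)a (p19's calculus is for lines between vertices of an ordering; its
expression is local: `expr321a_eq_amp`, bound p18 g8's `abs_expr321a_le`).  (iii) Nothing analytic is added: *"is in fact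
convergent"* ((3.21)a; rows of p20/p39), *"has positive degree"* (p18 g8 `B3Eq322PositiveDegree`), the resummation (3.22) → (3.23)
(p18 g8 `sum_expr321b_eq`), (3.24) and the ℤ³ forms (p40 g71 `B3Eq322ZeroLattice`) are the cited cells.  (iv) p18 g3's third model
graph `g321Y` with the same external structure (READING NOTE in `B3Sect3LowestOrderGraphs`) is not pictured in print and not treated.
Unit `lit-balaban-p37-g90` (literature-prover-lit-balaban-p37-g90-0), HOME `run/shared/lean/pub/lit-balaban/`, 2026-08-23.
-/

open Finset

namespace Literature.MathematicalPhysics.QuantumFieldTheory.Balaban1983to89.B3Eq321Pictures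

/-! ## §1 The drawn objects: (3.21)a, (3.21)b, and the three pictures of (3.22) -/

section Pictures

open B3Prop1 B3Cor23Concrete B3Sect3LowestOrderGraphs B3Eq37Pictures B3Eq332Pictures

variable {nbar : ℕ}

/-! ### (3.21)a in closed form: one vertex (1.8)_{2,0}, the wavy loop, two straight legs (one arrowed) -/

/-- The single vertex of (3.21)a is of the kind (1.8)_{n=2,n′=0} (p18's `g321a`). [cite: Balaban1983Higgs3, (3.21) p.438] -/
def kind321a : Fin 1 → VertexKind := fun _ => .v18 2 0

/-- the φ′-leg `j` of the vertex of (3.21)a (`j = 0`: the arrowed one, `j = 1`: the plain one). [cite: Balaban1983Higgs3, (1.17) p.415] -/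
def aLeg (j : Fin 2) : Leg kind321a := ⟨0, .inl j⟩

/-- the A′-leg `j` of the vertex of (3.21)a (both lie on the wavy loop). [cite: Balaban1983Higgs3, (1.17) p.415] -/
def wLeg (j : Fin 2) : Leg kind321a := ⟨0, .inr j⟩

/-- The lines of (3.21)a (p18's `g321a.other`, verbatim): the two A′-legs are joined (the wavy loop), the φ′-legs are external.
[cite: Balaban1983Higgs3, (3.21) p.438] -/
def other321a : Leg kind321a → Option (Leg kind321a)
  | ⟨_, .inl _⟩ => none
  | ⟨i, .inr j⟩ => some ⟨i, .inr j.rev⟩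

/-! ### (3.21)b in closed form: two vertices (1.8)_{1,0} (p26's `kind36`), the arrowed φ′-line, the A′-line -/

/-- The lines of (3.21)b (p18's `g321b.other`, verbatim): the ARROWED φ′-leg `0` of `x = 0` is joined to the plain φ′-leg `1` of
`x′ = 1` (the φ′-line, differentiated at x), the A′-legs are joined (the wavy line), the plain leg of x and the arrowed leg of x′ are
external. [cite: Balaban1983Higgs3, (3.21) p.438] -/
def other321b : Leg kind36 → Option (Leg kind36)
  | ⟨i, .inl j⟩ =>
      if i.val = 0 ∧ j.val = 0 then some ⟨1, .inl ⟨1, by show 1 < 2; omega⟩⟩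
      else if i.val = 1 ∧ j.val = 1 then some ⟨0, .inl ⟨0, by show 0 < 2; omega⟩⟩ else none
  | ⟨i, .inr _⟩ => some ⟨i.rev, .inr ⟨0, by show 0 < 1; omega⟩⟩

variable (hn : 1 ≤ nbar) (hn2 : 2 ≤ nbar)

/-- p18's `g321a`: one vertex `kind321a`, lines `other321a` (definitionally). [cite: Balaban1983Higgs3, (3.21) p.438] -/
theorem g321a_kind_nV : (g321a nbar hn2).kind = kind321a ∧ (g321a nbar hn2).nV = 1 := ⟨rfl, rfl⟩

/-- … the lines. [cite: Balaban1983Higgs3, (3.21) p.438] -/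
theorem g321a_other (x : Leg kind321a) : (g321a nbar hn2).other x = other321a x := by
  obtain ⟨i, y⟩ := x
  rcases y with j | j <;> rfl

/-- p18's `g321b`: the two vertices `kind36` of p26, lines `other321b` (definitionally). [cite: Balaban1983Higgs3, (3.21) p.438] -/
theorem g321b_kind_nV : (g321b nbar hn).kind = kind36 ∧ (g321b nbar hn).nV = 2 := ⟨rfl, rfl⟩

/-- … the lines. [cite: Balaban1983Higgs3, (3.21) p.438] -/
theorem g321b_other (x : Leg kind36) : (g321b nbar hn).other x = other321b x := by
  obtain ⟨i, y⟩ := x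
  rcases y with j | j <;> rfl

/-- **Line kinds of (3.21)a**: the two A′-legs form the wavy LOOP, both straight legs are external — DECIDED.
[cite: Balaban1983Higgs3, (3.21) p.438] -/
theorem g321a_lines : (∀ j : Fin 2, other321a (wLeg j) = some (wLeg j.rev)) ∧ ∀ j : Fin 2, other321a (aLeg j) = none := by
  refine ⟨by decide, by decide⟩

/-- **Line kinds of (3.21)b**: the φ′-line (straight) joins the ARROWED leg of x to the plain leg of x′, the A′-line (wavy) joins
the two A′-legs, and the external legs are exactly the plain leg of x and the arrowed leg of x′ — DECIDED.
[cite: Balaban1983Higgs3, (3.21) p.438] -/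
theorem g321b_lines :
    other321b (sLeg 0 0) = some (sLeg 1 1) ∧ other321b (sLeg 1 1) = some (sLeg 0 0) ∧
      (∀ i : Fin 2, other321b (vLeg i) = some (vLeg i.rev)) ∧ other321b (sLeg 0 1) = none ∧ other321b (sLeg 1 0) = none := by
  refine ⟨by decide, by decide, by decide, by decide, by decide⟩

/-- **The external legs of (3.21)b are exactly the plain φ′-leg of x and the arrowed φ′-leg of x′.**
[cite: Balaban1983Higgs3, (3.21) p.438] -/
theorem other321b_eq_none_iff : ∀ x : Leg kind36, other321b x = none ↔ x = sLeg 0 1 ∨ x = sLeg 1 0 := by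
  decide

/-- **The arrowheads**: in (3.21)b the external leg of x′ carries the covariant differentiation of its vertex and the external leg
of x does not; in (3.21)a the leg `0` is the arrowed one (p26's `legDiffs` on p18's graphs). [cite: Balaban1983Higgs3, (3.21) p.438] -/
theorem legDiffs_ext321b : legDiffs (g321b nbar hn) (sLeg 1 0) = 1 ∧ legDiffs (g321b nbar hn) (sLeg 0 1) = 0 := ⟨rfl, rfl⟩

/-- … and in (3.21)a the leg `0` is the arrowed one. [cite: Balaban1983Higgs3, (3.21) p.438] -/
theorem legDiffs_ext321a : legDiffs (g321a nbar hn2) (aLeg 0) = 1 ∧ legDiffs (g321a nbar hn2) (aLeg 1) = 0 := ⟨rfl, rfl⟩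

/-! ### The pictures -/

/-- **(3.21)a** p. 438 [PDF 28] as a localized picture: p18's `g321a`, natural localization (one vertex: both straight legs sit
at it). [cite: Balaban1983Higgs3, (3.21) p.438] -/
def pic321a (hn2 : 2 ≤ nbar) : LocPicture nbar := LocPicture.natural (g321a nbar hn2)

/-- **(3.21)b** p. 438 [PDF 28] (= the LHS of (3.22)) as a localized picture: p18's `g321b`, the plain leg at x, the arrowed leg at
x′. [cite: Balaban1983Higgs3, (3.21) p.438] -/
def pic321b (hn : 1 ≤ nbar) : LocPicture nbar := LocPicture.natural (g321b nbar hn)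

/-- The localization of RHS₂ of (3.22) in closed form: legs on internal lines stay, external legs go to `x = 0` (p26's `loc37`
pattern). [cite: Balaban1983Higgs3, p.417] -/
def loc322 : Leg kind36 → Fin 2 := fun x => if (other321b x).isSome then x.1 else 0

/-- **RHS₂ of (3.22)** p. 439 [PDF 29], the local vertex (drawn: the vertex x with BOTH external straight legs — the plain one and
the arrowed one — and the wavy line + arrowed straight line running to the small circle x′): by p. 417 p18's `g321b` *with both
external legs localized in x*. [cite: Balaban1983Higgs3, (3.22) p.439] -/
def pic322loc (hn : 1 ≤ nbar) : LocPicture nbar where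
  G := g321b nbar hn
  loc := loc322
  loc_int x hx := by
    have hx' : (other321b x).isSome := by rw [← g321b_other hn x]; exact hx
    show loc322 x = x.1
    simp only [loc322, hx', if_true]

/-- **RHS₁ of (3.22)** p. 439 [PDF 29]: (3.21)b inscribed "+α", its arrowed external leg (of x′) decorated relative to x — a
`HolderPicture` (this seat's `B3Eq332Pictures`) on `pic321b`. [cite: Balaban1983Higgs3, (3.22) p.439] -/
def pic322holder (hn : 1 ≤ nbar) (α : ℝ) : HolderPicture nbar where
  toLocPicture := pic321b hn
  α := α
  wleg := sLeg 1 0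
  base := (0 : Fin 2)
  wleg_ext := g321b_lines.2.2.2.2

/-- A picture equation [LHS] = [decorated term] + [local term], as printed in (3.22). [cite: Balaban1983Higgs3, (3.22) p.439] -/
structure PicEq322 (nbar : ℕ) where
  /-- the left side -/
  lhs : LocPicture nbar
  /-- the first (decorated, positive-degree) term of the right side -/
  holderTerm : HolderPicture nbar
  /-- the second (local vertex) term of the right side -/
  localTerm : LocPicture nbar

/-- **(3.22)** p. 439 [PDF 29]: [(3.21)b] = [(3.21)b +α ∕ −(1+α)] + [local vertex]. [cite: Balaban1983Higgs3, (3.22) p.439] -/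
def pic322 (hn : 1 ≤ nbar) (α : ℝ) : PicEq322 nbar := ⟨pic321b hn, pic322holder hn α, pic322loc hn⟩

/-- (3.21)b: each leg at its own vertex. [cite: Balaban1983Higgs3, (3.21) p.438] -/
theorem pic321b_loc (x : Leg kind36) : (pic321b hn).loc x = x.1 := rfl

/-- RHS₂: the localization is `loc322` (definitionally). [cite: Balaban1983Higgs3, (3.22) p.439] -/
theorem pic322loc_loc (x : Leg kind36) : (pic322loc hn).loc x = loc322 x := rfl

/-- **RHS₂: BOTH external legs are localized at x** (the vertex `0`); the internal legs stay — DECIDED.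
[cite: Balaban1983Higgs3, (3.22) p.439] -/
theorem loc322_eq : ∀ x : Leg kind36, loc322 x = if x = sLeg 0 1 ∨ x = sLeg 1 0 then 0 else x.1 := by
  decide

/-- in particular at the two external legs. [cite: Balaban1983Higgs3, (3.22) p.439] -/
theorem loc322_ext : loc322 (sLeg 0 1) = 0 ∧ loc322 (sLeg 1 0) = 0 := by decide

/-- The three pictures of (3.22) have the SAME drawn graph (p. 417 *"the same graph G"*). [cite: Balaban1983Higgs3, p.417] -/
theorem pic322_G (α : ℝ) :
    (pic322loc hn).G = (pic321b hn).G ∧ (pic322holder hn α).G = (pic321b hn).G ∧ (pic321b hn).G = g321b nbar hn :=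
  ⟨rfl, rfl, rfl⟩

/-- RHS₂ ≠ LHS as localized pictures (they differ at the arrowed leg of x′). [cite: Balaban1983Higgs3, (3.22) p.439] -/
theorem pic322loc_ne_pic321b : pic322loc hn ≠ pic321b hn := by
  intro h
  have hF : ∀ x : Leg (pic322loc hn).G.kind, ((pic322loc hn).loc x).val = x.1.val := by
    rw [h]; intro x; rfl
  have h1 : (loc322 (sLeg 1 0)).val = 1 := hF (sLeg 1 0)
  revert h1
  decide

/-- RHS₁: the LHS's graph and localization, exponent `α`, decorated leg = the arrowed external leg of x′, base = x.
[cite: Balaban1983Higgs3, (3.22) p.439] -/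
theorem pic322holder_data (α : ℝ) :
    (pic322holder hn α).toLocPicture = pic321b hn ∧ (pic322holder hn α).α = α ∧
      (pic322holder hn α).wleg = sLeg 1 0 ∧ (pic322holder hn α).base = (0 : Fin 2) :=
  ⟨rfl, rfl, rfl, rfl⟩

/-- (3.22) = (LHS, RHS₁, RHS₂). [cite: Balaban1983Higgs3, (3.22) p.439] -/
theorem pic322_terms (α : ℝ) :
    (pic322 hn α).lhs = pic321b hn ∧ (pic322 hn α).holderTerm = pic322holder hn α ∧ (pic322 hn α).localTerm = pic322loc hn :=
  ⟨rfl, rfl, rfl⟩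

end Pictures

/-! ## §2 Count data: the leg label, the degrees, and the datum of (3.21)b derived from the drawing -/

section Counting

open B3Prop1 B3Cor23Concrete B3Sect3LowestOrderGraphs B3Eq37Pictures B3Eq332Pictures
open B3Ineq215 B3Ineq213 B3FreeLine B3Eq322Member

variable {nbar : ℕ}

noncomputable section

/-- **The printed LEG LABEL of a decorated picture**: the differentiations already carried by the decorated leg (its arrowheads,
p26's `legDiffs`) plus the Hölder order α — "−(1+α)" in (3.22)/(3.12)/(3.30), "−α" in (3.20)/(3.32).
[cite: Balaban1983Higgs3, (3.22) p.439] -/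
def legOrder (H : HolderPicture nbar) : ℝ := (legDiffs H.G H.wleg : ℝ) + H.α

variable (hn : 1 ≤ nbar) (hn2 : 2 ≤ nbar)

/-- **"−(1+α)"**: the decorated leg of RHS₁ of (3.22) is the ARROWED external leg of x′, so its label is 1 + α — DERIVED from the
drawn arrowhead. [cite: Balaban1983Higgs3, (3.22) p.439] -/
theorem legOrder_pic322holder (α : ℝ) : legOrder (pic322holder hn α) = 1 + α := by
  show ((legDiffs (g321b nbar hn) (sLeg 1 0) : ℕ) : ℝ) + α = 1 + α
  rw [(legDiffs_ext321b hn).1, Nat.cast_one]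

/-- **"−α"** for comparison: a decorated VECTOR leg (the blob of (3.32), `B3Eq332Pictures.VBlob.holder`) carries no arrowhead, so
its label is α. [cite: Balaban1983Higgs3, (3.32) p.442] -/
theorem legOrder_vholder (B : VBlob nbar) (α : ℝ) : legOrder (B.holder α) = α := by
  show ((legDiffs B.G B.e' : ℕ) : ℝ) + α = α
  have hv := B.vec'
  generalize B.e' = x at hv ⊢
  obtain ⟨i, j | j⟩ := x
  · simp at hv
  · simp [legDiffs]

/-- **"All the remaining divergent graphs of this type have degrees equal to 0"** (p. 438): both graphs of (3.21) have D = 3 − d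
(p18's `g321a_deg`, `g321b_deg`), = 0 at d = 3. [cite: Balaban1983Higgs3, (3.21) p.438] -/
theorem g321b_degZero : (g321b nbar hn).deg 3 = 0 := by
  rw [g321b_deg]; norm_num

/-- … and so does (3.21)a. [cite: Balaban1983Higgs3, (3.21) p.438] -/
theorem g321a_degZero : (g321a nbar hn2).deg 3 = 0 := by
  rw [g321a_deg]; norm_num

/-- **"The first graph on the right side has positive degree"**: RHS₁ of (3.22) has degree D((3.21)b) + α = 3 − d + α
(`B3Eq332Pictures.HolderPicture.deg`), i.e. α > 0 at d = 3.  (Analytic content: p18 g8's `B3Eq322Member.posSubgraphs_memberK322` /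
`B3Eq322PositiveDegree`, cited not restated.) [cite: Balaban1983Higgs3, (3.22) p.439] -/
theorem deg_pic322holder (α : ℝ) (d : ℕ) :
    (pic322holder hn α).deg d = 3 - (d : ℝ) + α ∧ (pic322holder hn α).deg 3 = α ∧ (0 < α → 0 < (pic322holder hn α).deg 3) := by
  have h : ∀ d : ℕ, (pic322holder hn α).deg d = 3 - (d : ℝ) + α := fun d => by
    show ((g321b nbar hn).deg d : ℝ) + α = _
    rw [g321b_deg]; push_cast; ring
  refine ⟨h d, by rw [h 3]; push_cast; ring, fun hα => by rw [h 3]; push_cast; linarith⟩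

/-! ### The p19 count datum of (3.21)b DERIVED from the drawn graph (p26's `countsOf`) -/

/-- The enumeration of the two lines of (3.21)b: line `0` = the φ′-line from the arrowed leg `sLeg 0 0` of x to the plain leg
`sLeg 1 1` of x′, line `1` = the A′-line `vLeg 0`–`vLeg 1` (p18 g8's `graph322`: line `0` scalar carrying the differentiation of x,
line `1` vector). [cite: Balaban1983Higgs3, (3.21) p.438] -/
def fst321 : Fin 2 → Leg kind36 := fun l => if l = 0 then sLeg 0 0 else vLeg 0

/-- second endpoints of the two lines of (3.21)b. [cite: Balaban1983Higgs3, (3.21) p.438] -/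
def snd321 : Fin 2 → Leg kind36 := fun l => if l = 0 then sLeg 1 1 else vLeg 1

/-- The four properties of an enumeration, DECIDED on the closed form. [cite: Balaban1983Higgs3, (2.16) p.428] -/
theorem enum321_props :
    (∀ l : Fin 2, other321b (fst321 l) = some (snd321 l)) ∧
    (∀ x y : Leg kind36, other321b x = some y →
      ∃ l : Fin 2, (fst321 l = x ∧ snd321 l = y) ∨ (fst321 l = y ∧ snd321 l = x)) ∧
    (∀ l l' : Fin 2, (fst321 l = fst321 l' ∨ fst321 l = snd321 l') → l = l') ∧
    (∀ v : Fin 2, ∃ l : Fin 2, (fst321 l).1 = v ∨ (snd321 l).1 = v) := by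
  refine ⟨by decide, by decide, by decide, by decide⟩

/-- **The lines of (3.21)b enumerated as in `B3Eq322Member.graph322`.** [cite: Balaban1983Higgs3, (3.21) p.438] -/
def enum321b : LineEnum (g321b nbar hn) 2 where
  fst := fst321
  snd := snd321
  pair l := by rw [g321b_other]; exact enum321_props.1 l
  cover x y h := enum321_props.2.1 x y (by rwa [g321b_other] at h)
  nodup := enum321_props.2.2.1
  touches := enum321_props.2.2.2

/-- **Line kinds are visible**: line `0` is a SCALAR line from the arrowed leg of x to the plain leg of x′, line `1` a VECTOR line;
both run x → x′. [cite: Balaban1983Higgs3, (1.17) p.415] -/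
theorem enum321b_kinds :
    ((enum321b hn).fst 0 = sLeg 0 0 ∧ (enum321b hn).snd 0 = sLeg 1 1 ∧ (enum321b hn).fst 1 = vLeg 0 ∧ (enum321b hn).snd 1 = vLeg 1) ∧
      (((enum321b hn).fst 0).2.isLeft = true ∧ ((enum321b hn).fst 1).2.isLeft = false) ∧
        ∀ l : Fin 2, ((enum321b hn).fst l).1 = (0 : Fin 2) ∧ ((enum321b hn).snd l).1 = (1 : Fin 2) := by
  show (fst321 0 = sLeg 0 0 ∧ snd321 0 = sLeg 1 1 ∧ fst321 1 = vLeg 0 ∧ snd321 1 = vLeg 1) ∧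
    ((fst321 0).2.isLeft = true ∧ (fst321 1).2.isLeft = false) ∧ ∀ l : Fin 2, (fst321 l).1 = 0 ∧ (snd321 l).1 = 1
  decide

/-- kernel: equality of count data from equality of their data fields. [folklore] -/
private theorem counts_ext {V : Type} [Fintype V] [DecidableEq V] {m : ℕ} {C C' : Counts V m} (h1 : C.src = C'.src)
    (h2 : C.tgt = C'.tgt) (h3 : C.diffOn = C'.diffOn) (h4 : C.vecLegAvg = C'.vecLegAvg) (h5 : C.etaPow = C'.etaPow)
    (h6 : C.d = C'.d) (h7 : C.L = C'.L) (h8 : C.δ₁ = C'.δ₁) : C = C' := by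
  cases C; cases C'
  simp only at h1 h2 h3 h4 h5 h6 h7 h8
  subst h1 h2 h3 h4 h5 h6 h7 h8
  rfl

/-- p18's `g321b` carries p26's differentiations `legDiffs36` (`1` on the leg `0` of each vertex (1.8)) and no averaged legs.
[cite: Balaban1983Higgs3, (2.1) p.422] -/
theorem legDiffs_g321b (x : Leg kind36) : legDiffs (g321b nbar hn) x = legDiffs36 x ∧ legAvg (g321b nbar hn) x = 0 := by
  obtain ⟨i, j | j⟩ := x <;> exact ⟨rfl, rfl⟩

/-- The pattern read off the drawn graph: only the vertex x differentiates, only the φ′-line `0` — p18 g8's `graph322.diffOn` —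
DECIDED. [cite: Balaban1983Higgs3, (2.14) p.427] -/
theorem pattern321b : ∀ v l : Fin 2,
    (if (fst321 l).1 = v then legDiffs36 (fst321 l) else 0) + (if (snd321 l).1 = v then legDiffs36 (snd321 l) else 0) =
      if v = 0 ∧ l = 0 then 1 else 0 := by
  decide

/-- **THE COUNT DATUM `graph322` OF p18 g8 IS THE ONE READ OFF THE DRAWN GRAPH (3.21)b** (`d = 3`, `L = 2`, `δ₁ = 1`): endpoints
x → x′ for both lines, the differentiation of x on the φ′-line `0` only, no averaged legs, proper η-power `0` of (1.8)_{1,0}.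
[cite: Balaban1983Higgs3, (3.21) p.438, (2.14) p.427] -/
theorem countsOf_g321b :
    countsOf (g321b nbar hn) (enum321b hn) 3 2 1 (by norm_num) le_rfl one_pos = graph322 := by
  refine counts_ext ?_ ?_ ?_ ?_ ?_ rfl rfl rfl
  · funext l
    show (fst321 l).1 = 0
    exact ((enum321b_kinds hn).2.2 l).1
  · funext l
    show (snd321 l).1 = 1
    exact ((enum321b_kinds hn).2.2 l).2
  · funext v l
    show (if (fst321 l).1 = v then legDiffs (g321b nbar hn) (fst321 l) else 0) +
        (if (snd321 l).1 = v then legDiffs (g321b nbar hn) (snd321 l) else 0) = if v = (0 : Fin 2) ∧ l = 0 then 1 else 0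
    rw [(legDiffs_g321b hn _).1, (legDiffs_g321b hn _).1]
    exact pattern321b v l
  · funext v l
    show (if (fst321 l).1 = v then legAvg (g321b nbar hn) (fst321 l) else 0) +
        (if (snd321 l).1 = v then legAvg (g321b nbar hn) (snd321 l) else 0) = 0
    rw [(legDiffs_g321b hn _).2, (legDiffs_g321b hn _).2]
    simp
  · funext v
    show ((VertexKind.v18 1 0).etaCount 3 - 3).toNat = 0
    decide

/-- (2.2) for the first block of the derived datum: degree `1` if the φ′-line is shrunk first, `2` if the A′-line is (p18 g8's
`degQ_one`, transported). [cite: Balaban1983Higgs3, (2.2) p.423] -/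
theorem degQ_one_countsOf_g321b (σ : Equiv.Perm (Fin 2)) :
    degQ (relabelCounts (countsOf (g321b nbar hn) (enum321b hn) 3 2 1 (by norm_num) le_rfl one_pos) σ) 1 (0 : Fin 2) =
      if σ 0 = 0 then 1 else 2 := by
  rw [countsOf_g321b]; exact degQ_one σ

/-- **"degrees equal to 0", DERIVED**: the whole drawn graph (3.21)b has degree `0` along either ordering of its lines (p18 g8's
`degQ_two`) — equal to p18 g3's catalogue degree `g321b_deg 3`. [cite: Balaban1983Higgs3, (3.21) p.438] -/
theorem degQ_two_countsOf_g321b (σ : Equiv.Perm (Fin 2)) :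
    degQ (relabelCounts (countsOf (g321b nbar hn) (enum321b hn) 3 2 1 (by norm_num) le_rfl one_pos) σ) 2 (0 : Fin 2) = 0 ∧
      (g321b nbar hn).deg 3 = 0 :=
  ⟨by rw [countsOf_g321b]; exact degQ_two σ, g321b_degZero hn⟩

/-- **"+α ⇒ positive degree" in p19's calculus**: with p18 g8's extra line exponent `κ322` (½ on the φ′-line, the "+α" with
α = ½) the generalized graph of RHS₁ has degree ½ > 0 along either ordering (`degQK_two`, transported to the derived datum).
[cite: Balaban1983Higgs3, (3.22) p.439] -/
theorem degQK_two_countsOf_g321b (σ : Equiv.Perm (Fin 2)) :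
    degQK (relabelCounts (countsOf (g321b nbar hn) (enum321b hn) 3 2 1 (by norm_num) le_rfl one_pos) σ) (κ322 ∘ σ) 2
      (0 : Fin 2) = 1 / 2 := by
  rw [countsOf_g321b]; exact degQK_two σ

end

end Counting

/-! ## §3 The dictionary: (3.21)a,b and the pictures of (3.22) ↦ `expr321a`, `expr321b`, `holder322`, `expr323` -/

section Dictionary

open B3Prop1 B3Cor23Concrete B3Sect3LowestOrderGraphs B3Eq37Pictures B3Eq332Pictures
open LatticeFieldCalculus B3Sect3ScalarSelfEnergy B3Eq322OneLegDifferentiated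

open scoped RealInnerProductSpace

noncomputable section

variable {nbar : ℕ} {P : Params} {j : ℕ} {W : Type*} [NormedAddCommGroup W] [InnerProductSpace ℝ W]

/-- **The kernel of (3.21)b READ OFF ITS LINES AND VERTICES** (with the charge matrices): the φ′-line arrowed at x ↦
(∂^η_μG_{(j)}(0))(x,x′) (r15's `d1Kernel`), the A′-line ↦ G_{(j′)}(x,x′), the vertices (1.8)_{1,0} ↦ g(x)·q, g′(x′)·q — p18 g8's
`ker321 η μ G_{(j)}(0) G_{(j′)} g g′ (x,x′)` times q² (the integrand of the bracket of (3.23), `bracket323_eq`).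
[cite: Balaban1983Higgs3, (3.23) p.439] -/
def sg321 (η : ℝ) (μ : Fin P.d) (q : W →ₗ[ℝ] W) (G0 Gj : Kernel P j) (g g' : SiteField P j ℝ) :
    Site P j → Site P j → W →ₗ[ℝ] W :=
  fun x x' => ker321 η μ G0 Gj g g' x x' • (q ∘ₗ q)

/-- kernel: a sum over the positions of two vertices is a double sum. [folklore] -/
private theorem sum_arrow_fin_two {α M : Type*} [Fintype α] [AddCommMonoid M] (f : (Fin 2 → α) → M) :
    ∑ xs : Fin 2 → α, f xs = ∑ a : α, ∑ b : α, f ![a, b] := by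
  rw [← (finTwoArrowEquiv α).symm.sum_comp f, Fintype.sum_prod_type]
  rfl

variable (hn : 1 ≤ nbar) (hn2 : 2 ≤ nbar)

/-- **(3.21)b ↦ the graph term**: the plain leg `φ` at x, the (arrowed) leg field `φ″` at x′ (each at its own vertex):
amp = Σ_{x,x′}η^{2d}⟪φ(x), Σ(x,x′)φ″(x′)⟫. [cite: Balaban1983Higgs3, (3.21) p.438] -/
theorem amp_pic321b_kernel2 (η : ℝ) (Sg : Site P j → Site P j → W →ₗ[ℝ] W) (φ φ'' : SiteField P j W) :
    (pic321b hn).amp (sLeg 0 1) (sLeg 1 0) η (kernel2 Sg) φ φ'' =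
      ∑ x : Site P j, ∑ x' : Site P j, η ^ (2 * P.d) * ⟪φ x, Sg x x' (φ'' x')⟫ := by
  unfold LocPicture.amp
  show ∑ xs : Fin 2 → Site P j, η ^ (2 * P.d) * ⟪φ (xs 0), kernel2 Sg xs (φ'' (xs 1))⟫ = _
  rw [sum_arrow_fin_two]
  rfl

/-- **RHS₂ of (3.22) ↦ the local term**: both legs at x, amp = Σ_{x,x′}η^{2d}⟪φ(x), Σ(x,x′)φ″(x)⟫ (*"with the summation over x′"*).
[cite: Balaban1983Higgs3, (3.22) p.439] -/
theorem amp_pic322loc_kernel2 (η : ℝ) (Sg : Site P j → Site P j → W →ₗ[ℝ] W) (φ φ'' : SiteField P j W) :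
    (pic322loc hn).amp (sLeg 0 1) (sLeg 1 0) η (kernel2 Sg) φ φ'' =
      ∑ x : Site P j, ∑ x' : Site P j, η ^ (2 * P.d) * ⟪φ x, Sg x x' (φ'' x)⟫ := by
  unfold LocPicture.amp
  rw [pic322loc_loc, pic322loc_loc, loc322_ext.1, loc322_ext.2]
  show ∑ xs : Fin 2 → Site P j, η ^ (2 * P.d) * ⟪φ (xs 0), kernel2 Sg xs (φ'' (xs 0))⟫ = _
  rw [sum_arrow_fin_two]
  rfl

/-- **(3.21)b IS p18 g8's `expr321b`** through the dictionary: with the kernel `sg321` read off the lines and the arrowed external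
leg read as (∂^η_μφ′)(x′) = `pdiff η⁻¹ μ φ′ x′` (the direction μ shared with the arrowed line, summed as in (3.23)),
`expr321b η q G_{(j)}(0) G_{(j′)} g g′ φ φ′ = Σ_μ amp[(3.21)b]`. [cite: Balaban1983Higgs3, (3.21) p.438] -/
theorem expr321b_eq_amp (η : ℝ) (q : W →ₗ[ℝ] W) (G0 Gj : Kernel P j) (g g' : SiteField P j ℝ) (φ φ' : SiteField P j W) :
    expr321b η q G0 Gj g g' φ φ' =
      ∑ μ : Fin P.d, (pic321b hn).amp (sLeg 0 1) (sLeg 1 0) η (kernel2 (sg321 η μ q G0 Gj g g')) φ (pdiff η⁻¹ μ φ') := by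
  unfold expr321b
  refine Finset.sum_congr rfl fun μ _ => ?_
  rw [amp_pic321b_kernel2]
  refine Finset.sum_congr rfl fun x _ => Finset.sum_congr rfl fun x' _ => ?_
  simp only [sg321, LinearMap.smul_apply, LinearMap.coe_comp, Function.comp_apply, real_inner_smul_right]

/-- **RHS₂ of (3.22) IS r15's pre-resummation (3.23) `expr323`** through the dictionary (p18 g8's reading in `eq322`):
`expr323 η q G_{(j)}(0) G_{(j′)} g g′ φ φ′ = Σ_μ amp[RHS₂]` — the bracket of (3.23) is the x′-sum of the kernel (`bracket323_eq`).
[cite: Balaban1983Higgs3, (3.23) p.439] -/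
theorem expr323_eq_amp (η : ℝ) (q : W →ₗ[ℝ] W) (G0 Gj : Kernel P j) (g g' : SiteField P j ℝ) (φ φ' : SiteField P j W) :
    expr323 η q G0 Gj g g' φ φ' =
      ∑ μ : Fin P.d, (pic322loc hn).amp (sLeg 0 1) (sLeg 1 0) η (kernel2 (sg321 η μ q G0 Gj g g')) φ (pdiff η⁻¹ μ φ') := by
  unfold expr323
  refine Finset.sum_congr rfl fun μ _ => ?_
  rw [amp_pic322loc_kernel2]
  refine Finset.sum_congr rfl fun x _ => ?_
  rw [bracket323_eq, Finset.sum_mul, Finset.mul_sum]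
  refine Finset.sum_congr rfl fun x' _ => ?_
  simp only [sg321, LinearMap.smul_apply, LinearMap.coe_comp, Function.comp_apply, real_inner_smul_right]
  rw [two_mul, pow_add]
  ring

/-- **The expression of a Hölder-decorated picture with scalar legs** (the undecorated external leg `e` carrying `φ`, the decorated
leg carrying the field `φ″`, a distance `dist`): Σ over all vertex positions of η^{(#vertices)d}⟪φ(xs(loc e)), (|x_b − x_w|^α·K(xs))
(|x_b − x_w|^{−α}·(φ″(x_w) − φ″(x_b)))⟫, x_w = xs(loc wleg), x_b = xs(base) — the "+α" multiplies the kernel, the decorated leg reads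
its difference quotient of order α (the inserted-and-divided form of (3.19); p18 g8's `holder322` shape).
[cite: Balaban1983Higgs3, (3.22) p.439] -/
def ampD (H : HolderPicture nbar) (e : Leg H.G.kind) (η : ℝ) (dist : Site P j → Site P j → ℝ)
    (K : (Fin H.G.nV → Site P j) → W →ₗ[ℝ] W) (φ φ'' : SiteField P j W) : ℝ :=
  ∑ xs : Fin H.G.nV → Site P j, η ^ (H.G.nV * P.d) *
    ⟪φ (xs (H.loc e)), (dist (xs H.base) (xs (H.loc H.wleg)) ^ H.α • K xs)
      ((dist (xs H.base) (xs (H.loc H.wleg)) ^ H.α)⁻¹ • (φ'' (xs (H.loc H.wleg)) - φ'' (xs H.base)))⟫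

/-- RHS₁ of (3.22) with the kernel of (3.21)b and the arrowed leg ∂^η_μφ′, for one direction μ:
Σ_{x,x′}η^{2d}(k_μ(x,x′)|x−x′|^α)·⟪φ(x), q²(|x−x′|^{−α}((∂^η_μφ′)(x′) − (∂^η_μφ′)(x)))⟫ — the μ-summand of p18 g8's `holder322`.
[cite: Balaban1983Higgs3, (3.22) p.439] -/
theorem ampD_pic322holder (η α : ℝ) (dist : Site P j → Site P j → ℝ) (μ : Fin P.d) (q : W →ₗ[ℝ] W) (G0 Gj : Kernel P j)
    (g g' : SiteField P j ℝ) (φ φ' : SiteField P j W) :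
    ampD (pic322holder hn α) (sLeg 0 1) η dist (kernel2 (sg321 η μ q G0 Gj g g')) φ (pdiff η⁻¹ μ φ') =
      ∑ x : Site P j, ∑ x' : Site P j, η ^ (2 * P.d) * ((ker321 η μ G0 Gj g g' x x' * dist x x' ^ α) *
        ⟪φ x, q (q ((dist x x' ^ α)⁻¹ • (pdiff η⁻¹ μ φ' x' - pdiff η⁻¹ μ φ' x)))⟫) := by
  unfold ampD
  show ∑ xs : Fin 2 → Site P j, η ^ (2 * P.d) *
      ⟪φ (xs 0), (dist (xs 0) (xs 1) ^ α • kernel2 (sg321 η μ q G0 Gj g g') xs)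
        ((dist (xs 0) (xs 1) ^ α)⁻¹ • (pdiff η⁻¹ μ φ' (xs 1) - pdiff η⁻¹ μ φ' (xs 0)))⟫ = _
  rw [sum_arrow_fin_two]
  refine Finset.sum_congr rfl fun x _ => Finset.sum_congr rfl fun x' _ => ?_
  simp only [Matrix.cons_val_zero, Matrix.cons_val_one, kernel2, sg321, LinearMap.smul_apply, LinearMap.coe_comp,
    Function.comp_apply, real_inner_smul_right]
  ring

/-- **RHS₁ of (3.22) IS p18 g8's `holder322`** through the dictionary: `holder322 η α dist q G_{(j)}(0) G_{(j′)} g g′ φ φ′ = Σ_μ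
ampD[RHS₁]`. [cite: Balaban1983Higgs3, (3.22) p.439] -/
theorem holder322_eq_ampD (η α : ℝ) (dist : Site P j → Site P j → ℝ) (q : W →ₗ[ℝ] W) (G0 Gj : Kernel P j)
    (g g' : SiteField P j ℝ) (φ φ' : SiteField P j W) :
    holder322 η α dist q G0 Gj g g' φ φ' =
      ∑ μ : Fin P.d, ampD (pic322holder hn α) (sLeg 0 1) η dist (kernel2 (sg321 η μ q G0 Gj g g')) φ (pdiff η⁻¹ μ φ') := by
  unfold holder322
  exact Finset.sum_congr rfl fun μ _ => (ampD_pic322holder hn η α dist μ q G0 Gj g g' φ φ').symm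

/-- **(3.22) IS p18 g8's `eq322` through the dictionary** — *"The second expression is transformed in a way similar to (3.17) and
(3.20): [(3.21)b] = [+α ∕ −(1+α)] + [local vertex] (3.22)"*: for every η, every exponent α, every `dist` positive off the diagonal
(in print |x−x′|), all line kernels, localizations and fields, Σ_μ amp[(3.21)b] = Σ_μ ampD[RHS₁] + Σ_μ amp[RHS₂], by p18 g8's PROVED
`eq322` (`expr321b = rem322 + expr323`) and `rem322_eq_holder322`. [cite: Balaban1983Higgs3, (3.22) p.439] -/
theorem eq322_pic (η α : ℝ) (dist : Site P j → Site P j → ℝ) (hpos : ∀ x x' : Site P j, x ≠ x' → 0 < dist x x')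
    (q : W →ₗ[ℝ] W) (G0 Gj : Kernel P j) (g g' : SiteField P j ℝ) (φ φ' : SiteField P j W) :
    ∑ μ : Fin P.d, (pic321b hn).amp (sLeg 0 1) (sLeg 1 0) η (kernel2 (sg321 η μ q G0 Gj g g')) φ (pdiff η⁻¹ μ φ') =
      ∑ μ : Fin P.d, ampD (pic322holder hn α) (sLeg 0 1) η dist (kernel2 (sg321 η μ q G0 Gj g g')) φ (pdiff η⁻¹ μ φ') +
        ∑ μ : Fin P.d, (pic322loc hn).amp (sLeg 0 1) (sLeg 1 0) η (kernel2 (sg321 η μ q G0 Gj g g')) φ (pdiff η⁻¹ μ φ') := by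
  rw [← expr321b_eq_amp, ← holder322_eq_ampD, ← expr323_eq_amp, ← rem322_eq_holder322 η α dist hpos]
  exact eq322 η q G0 Gj g g' φ φ'

/-- the same for the recorded triple `pic322`. [cite: Balaban1983Higgs3, (3.22) p.439] -/
theorem eq322_pic' (η α : ℝ) (dist : Site P j → Site P j → ℝ) (hpos : ∀ x x' : Site P j, x ≠ x' → 0 < dist x x')
    (q : W →ₗ[ℝ] W) (G0 Gj : Kernel P j) (g g' : SiteField P j ℝ) (φ φ' : SiteField P j W) :
    ∑ μ : Fin P.d, (pic322 hn α).lhs.amp (sLeg 0 1) (sLeg 1 0) η (kernel2 (sg321 η μ q G0 Gj g g')) φ (pdiff η⁻¹ μ φ') =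
      ∑ μ : Fin P.d, ampD (pic322 hn α).holderTerm (sLeg 0 1) η dist (kernel2 (sg321 η μ q G0 Gj g g')) φ (pdiff η⁻¹ μ φ') +
        ∑ μ : Fin P.d, (pic322 hn α).localTerm.amp (sLeg 0 1) (sLeg 1 0) η (kernel2 (sg321 η μ q G0 Gj g g')) φ
          (pdiff η⁻¹ μ φ') :=
  eq322_pic hn η α dist hpos q G0 Gj g g' φ φ'

/-! ### (3.21)a: one vertex, a local expression -/

/-- A one-point kernel as a function of the position of the single vertex `x = xs 0`. [cite: Balaban1983Higgs3, (3.21) p.438] -/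
def kernel1 (c : Site P j → W →ₗ[ℝ] W) (xs : Fin 1 → Site P j) : W →ₗ[ℝ] W := c (xs 0)

/-- **The kernel of (3.21)a READ OFF THE DRAWING**: the wavy loop ↦ the diagonal G(x,x) of the A′-propagator with the vertex's
factor η (p. 413, (1.8)_{2,0}: ½η·Σ_bη^d[(D^ηφ′)(b)·q²φ′(b_−)](A′_b)², couplings and ½ extracted as in p18 g8's `expr321a`), the
localization g(x), the charge matrices q². [cite: Balaban1983Higgs3, (3.21) p.438] -/
def k321a (η : ℝ) (q : W →ₗ[ℝ] W) (G : Kernel P j) (g : SiteField P j ℝ) : Site P j → W →ₗ[ℝ] W :=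
  fun x => (η * G x x * g x) • (q ∘ₗ q)

/-- **(3.21)a ↦ a LOCAL expression**: one drawn vertex, so both straight legs are read at the same point:
amp = Σ_x η^d⟪φ(x), c(x)φ″(x)⟫ (p26's `amp_natural_oneVertex`). [cite: Balaban1983Higgs3, (3.21) p.438] -/
theorem amp_pic321a (η : ℝ) (c : Site P j → W →ₗ[ℝ] W) (φ φ'' : SiteField P j W) :
    (pic321a hn2).amp (aLeg 1) (aLeg 0) η (kernel1 c) φ φ'' = ∑ x : Site P j, η ^ P.d * ⟪φ x, c x (φ'' x)⟫ := by
  unfold pic321a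
  rw [amp_natural_oneVertex (g321a nbar hn2) rfl]
  show ∑ xs : Fin 1 → Site P j, η ^ P.d * ⟪φ (xs 0), c (xs 0) (φ'' (xs 0))⟫ = _
  exact Fintype.sum_equiv (Equiv.funUnique (Fin 1) (Site P j)) _ _ fun xs => by
    show _ = η ^ P.d * ⟪φ (xs default), c (xs default) (φ'' (xs default))⟫
    rw [show (default : Fin 1) = 0 from Subsingleton.elim _ _]

/-- **(3.21)a IS p18 g8's `expr321a`** through the dictionary: `expr321a η q G g φ φ′ = Σ_μ amp[(3.21)a]` with the kernel `k321a`
and the arrowed leg (∂^η_μφ′) — *"The expression corresponding to the first graph is in fact convergent, because ηG_k(x,x) is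
convergent to some finite constant"* is the cited analytic cell (p18 g8's `abs_expr321a_le` for the local-vertex shape).
[cite: Balaban1983Higgs3, (3.21) p.438] -/
theorem expr321a_eq_amp (η : ℝ) (q : W →ₗ[ℝ] W) (G : Kernel P j) (g : SiteField P j ℝ) (φ φ' : SiteField P j W) :
    expr321a η q G g φ φ' =
      ∑ μ : Fin P.d, (pic321a hn2).amp (aLeg 1) (aLeg 0) η (kernel1 (k321a η q G g)) φ (pdiff η⁻¹ μ φ') := by
  unfold expr321a
  refine Finset.sum_congr rfl fun μ _ => ?_
  rw [amp_pic321a]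
  refine Finset.sum_congr rfl fun x _ => ?_
  simp only [k321a, LinearMap.smul_apply, LinearMap.coe_comp, Function.comp_apply, real_inner_smul_right]

end

end Dictionary

end Literature.MathematicalPhysics.QuantumFieldTheory.Balaban1983to89.B3Eq321Pictures
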